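import Mathlib
import Summits.ResolutionOfSingularities.ResolutionOfSingularities.Theorems.HomologicalConductorSurfaceTerminationCubicTriangleData
import Mathlib.RingTheory.MvPolynomial.EulerIdentity
import HarnessLib

/-!
# Kill test `SurfaceTermination` (stmt-ResolutionOfSingularities-16488), (R-QH) piece 2 «CUBIC TRIANGLE», part 3:
# the (E) INITIAL PAIR and the EXIT for EVERY cubic cone through the coordinate triangle with `a₀ ≠ 0`, `a₂ ≠ 0`

Route `ResolutionOfSingularities/HomologicalConductor` (cell `res-hironaka`, chain W4.4), kill test `SurfaceTermination`
(stmt-16488), residue stub `stub_initialPairOfConstantGenus` ((E)-form); res-L0-w44-plan-1 CHAIN v21 (ρ35e) / v23 standing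
offer **(R-QH)**, piece 2, res-D-pv-045 g7. OURS; AI-written, weaker than expert review; nothing here is a statement of the
manuscript under review (Hironaka 2017) and no statement of it is used; no theorem here concludes the kill test or the crux.

THE FAMILY `f_a = a₀X₀²X₁ + a₁X₀²X₂ + a₂X₁²X₂ + a₃X₁²X₀ + a₄X₂²X₀ + a₅X₂²X₁ + a₆X₀X₁X₂` (`a : Fin 7 → k`): all plane
cubics through
`(1:0:0), (0:1:0), (0:0:1)` (over `k̄` every smooth plane cubic is projectively equivalent to one). DATA for part 2's
`initialPair_of_data`: the S-level ceiling is part 1's `mem_sq_of_mem_ca_cubicTriangle` (needs only `f_a ≠ 0`); the quadrics are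
`G₀ = ∂f_a/∂X₁` (`↦ a₀T²` on the ruling `(T,0,0)`, `= a₀` at `(1:0:0)`) and
`G₁ = a₀·∂f_a/∂X₂ − a₁·∂f_a/∂X₁` (`↦ 0` on the ruling,
`= a₀a₂` at `(0:1:0)`), both in `ca³` by part 1's floor. Hence, under the two scalar conditions **`a₀ ≠ 0`** (the curve is
smooth at `(1:0:0)` with tangent transversal to `X₂ = 0`) and **`a₂ ≠ 0`** (same at `(0:1:0)`):
* **`initialPair_cubicTriangle`** — for `A = k[x,y,z]` with `hker` (kernel `(f_a)`) and a weight valuation ring `O` (`hk`, `hx`,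
  `hW`): `g₀ = G₀(x,y,z)`, `g₁ = G₁(x,y,z)` form the (E) INITIAL PAIR at stage `0` (the residue stub's conclusion, `m' = 0`);
* **`exists_isRegularLocalRing_tower_cubicTriangle`** — with `CharP k p`, `IsFractionRing ↥A K`, `ringKrullDim ↥A = 2`:
  `∃ m, IsRegularLocalRing ↥(tower O A m)` — `SurfaceTermination`'s conclusion for every such `(A, O)`, every field `k`.
`a = (1,0,1,0,1,0,0)` recovers `…CubicConeExit` (p545347). References (mechanism only): S. B. Iyengar, R. Takahashi, IMRN 2016 §2
[`IyengarTakahashi2014`]; Mathlib `MvPolynomial.IsHomogeneous.pderiv` (Euler identity file).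
-/

noncomputable section

-- single-problem summit: the doubled namespace component `ResolutionOfSingularities` is forced
set_option linter.dupNamespace false

namespace Summit.ResolutionOfSingularities.ResolutionOfSingularities.Theorems.SurfaceTermination.CubicTriangle

open MvPolynomial
open Literature.RingTheory.CohomologyAnnihilator (cohomologyAnnihilatorOfDegree)
open Literature.AlgebraicGeometry.Resolution
open Summit.ResolutionOfSingularities.ResolutionOfSingularities.Theorems.NoZeno.Birth
open Summit.ResolutionOfSingularities.ResolutionOfSingularities.Theorems.HomologicalConductor

variable {k : Type} [Field k]

/-! ## §1 The family: vanishing at the coordinate points, homogeneity, the two Jacobian quadrics -/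

/-- `f_a` vanishes at the three coordinate points. [folklore] -/
theorem eval_single_cubicTriangle (a : Fin 7 → k) (i : Fin 3) :
    MvPolynomial.eval (Pi.single i 1 : Fin 3 → k)
      (C (a 0) * (X 0 ^ 2 * X 1) + C (a 1) * (X 0 ^ 2 * X 2) + C (a 2) * (X 1 ^ 2 * X 2) + C (a 3) * (X 1 ^ 2 * X 0) +
        C (a 4) * (X 2 ^ 2 * X 0) + C (a 5) * (X 2 ^ 2 * X 1) + C (a 6) * (X 0 * X 1 * X 2) : MvPolynomial (Fin 3) k) = 0 := by
  fin_cases i <;> simp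

/-- `f_a` is a form of degree `3`. [folklore] -/
theorem isHomogeneous_cubicTriangle (a : Fin 7 → k) :
      (C (a 0) * (X 0 ^ 2 * X 1) + C (a 1) * (X 0 ^ 2 * X 2) + C (a 2) * (X 1 ^ 2 * X 2) + C (a 3) * (X 1 ^ 2 * X 0) +
        C (a 4) * (X 2 ^ 2 * X 0) + C (a 5) * (X 2 ^ 2 * X 1) + C (a 6) * (X 0 * X 1 * X 2) : MvPolynomial (Fin 3) k).IsHomogeneous 3 := by
  have h2 : ∀ i j : Fin 3, (X i ^ 2 * X j : MvPolynomial (Fin 3) k).IsHomogeneous 3 := fun i j =>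
    (isHomogeneous_X_pow i 2).mul (isHomogeneous_X k j)
  have h3 : (X 0 * X 1 * X 2 : MvPolynomial (Fin 3) k).IsHomogeneous 3 :=
    ((isHomogeneous_X k 0).mul (isHomogeneous_X k 1)).mul (isHomogeneous_X k 2)
  exact (((((((h2 0 1).C_mul _).add ((h2 0 2).C_mul _)).add ((h2 1 2).C_mul _)).add ((h2 1 0).C_mul _)).add
    ((h2 2 0).C_mul _)).add ((h2 2 1).C_mul _)).add (h3.C_mul _)

/-- `∂f_a/∂X₁ = a₀X₀² + 2a₂X₁X₂ + 2a₃X₀X₁ + a₅X₂² + a₆X₀X₂`. [folklore] -/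
theorem pderiv_one_cubicTriangle (a : Fin 7 → k) : pderiv 1
      (C (a 0) * (X 0 ^ 2 * X 1) + C (a 1) * (X 0 ^ 2 * X 2) + C (a 2) * (X 1 ^ 2 * X 2) + C (a 3) * (X 1 ^ 2 * X 0) +
        C (a 4) * (X 2 ^ 2 * X 0) + C (a 5) * (X 2 ^ 2 * X 1) + C (a 6) * (X 0 * X 1 * X 2) : MvPolynomial (Fin 3) k) =
      C (a 0) * X 0 ^ 2 + 2 * C (a 2) * X 1 * X 2 + 2 * C (a 3) * X 0 * X 1 + C (a 5) * X 2 ^ 2 + C (a 6) * X 0 * X 2 := by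
  simp [Derivation.leibniz, Derivation.leibniz_pow, pderiv_X]
  ring

/-- `∂f_a/∂X₂ = a₁X₀² + a₂X₁² + 2a₄X₂X₀ + 2a₅X₂X₁ + a₆X₀X₁`. [folklore] -/
theorem pderiv_two_cubicTriangle (a : Fin 7 → k) : pderiv 2
      (C (a 0) * (X 0 ^ 2 * X 1) + C (a 1) * (X 0 ^ 2 * X 2) + C (a 2) * (X 1 ^ 2 * X 2) + C (a 3) * (X 1 ^ 2 * X 0) +
        C (a 4) * (X 2 ^ 2 * X 0) + C (a 5) * (X 2 ^ 2 * X 1) + C (a 6) * (X 0 * X 1 * X 2) : MvPolynomial (Fin 3) k) =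
      C (a 1) * X 0 ^ 2 + C (a 2) * X 1 ^ 2 + 2 * C (a 4) * X 2 * X 0 + 2 * C (a 5) * X 2 * X 1 + C (a 6) * X 0 * X 1 := by
  simp [Derivation.leibniz, Derivation.leibniz_pow, pderiv_X]
  ring

/-- `a₀ ≠ 0 ⇒ f_a ≠ 0` (`∂f_a/∂X₁ (1,0,0) = a₀`). [folklore] -/
theorem cubicTriangle_ne_zero (a : Fin 7 → k) (h0 : a 0 ≠ 0) :
      (C (a 0) * (X 0 ^ 2 * X 1) + C (a 1) * (X 0 ^ 2 * X 2) + C (a 2) * (X 1 ^ 2 * X 2) + C (a 3) * (X 1 ^ 2 * X 0) +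
        C (a 4) * (X 2 ^ 2 * X 0) + C (a 5) * (X 2 ^ 2 * X 1) + C (a 6) * (X 0 * X 1 * X 2) : MvPolynomial (Fin 3) k) ≠ 0 := by
  intro h
  have h' := congrArg (fun q => MvPolynomial.eval (![1, 0, 0] : Fin 3 → k) (pderiv 1 q)) h
  simp only [pderiv_one_cubicTriangle, map_zero] at h'
  simp at h'
  exact h0 h'

section Cone

variable {K : Type} [Field K] [Algebra k K] {a : Fin 7 → k} {x y z : K}
  (hker : RingHom.ker (MvPolynomial.aeval (R := k) (![x, y, z] : Fin 3 → K)).toRingHom =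
    Ideal.span {C (a 0) * (X 0 ^ 2 * X 1) + C (a 1) * (X 0 ^ 2 * X 2) + C (a 2) * (X 1 ^ 2 * X 2) + C (a 3) * (X 1 ^ 2 * X 0) +
        C (a 4) * (X 2 ^ 2 * X 0) + C (a 5) * (X 2 ^ 2 * X 1) + C (a 6) * (X 0 * X 1 * X 2)})
  {O : ValuationSubring K}
  (hW : ∀ (d : ℕ) (F : MvPolynomial (Fin 3) k), F.IsHomogeneous d → MvPolynomial.aeval ![x, y, z] F ≠ 0 →
    O.valuation (MvPolynomial.aeval ![x, y, z] F) = O.valuation x ^ d)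
  (hx : O.valuation x < 1) (hk : ∀ c : k, algebraMap k K c ∈ O) (h0 : a 0 ≠ 0) (h2 : a 2 ≠ 0)
include hker hW hx hk h0 h2

/-! ## §2 The (E) initial pair and the exit for the family -/

omit hker hW hx hk h0 h2 in
/-- `a₀·∂f_a/∂X₂ − a₁·∂f_a/∂X₁ = a₀a₂X₁² − a₁a₅X₂² + (a₀a₆ − 2a₁a₃)X₀X₁ + (2a₀a₄ − a₁a₆)X₀X₂ + 2(a₀a₅ − a₁a₂)X₁X₂`
(the `X₀²`
terms cancel: this quadric VANISHES on the ruling `(T,0,0)`). [folklore] -/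
theorem quadric_one_cubicTriangle (a : Fin 7 → k) :
    C (a 0) * pderiv 2 (C (a 0) * (X 0 ^ 2 * X 1) + C (a 1) * (X 0 ^ 2 * X 2) + C (a 2) * (X 1 ^ 2 * X 2) + C (a 3) * (X 1 ^ 2 * X 0) +
        C (a 4) * (X 2 ^ 2 * X 0) + C (a 5) * (X 2 ^ 2 * X 1) + C (a 6) * (X 0 * X 1 * X 2) : MvPolynomial (Fin 3) k) - C (a 1) * pderiv 1
      (C (a 0) * (X 0 ^ 2 * X 1) + C (a 1) * (X 0 ^ 2 * X 2) + C (a 2) * (X 1 ^ 2 * X 2) + C (a 3) * (X 1 ^ 2 * X 0) +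
        C (a 4) * (X 2 ^ 2 * X 0) + C (a 5) * (X 2 ^ 2 * X 1) + C (a 6) * (X 0 * X 1 * X 2) : MvPolynomial (Fin 3) k) =
      (C (a 0 * a 2) * X 1 ^ 2 - C (a 1 * a 5) * X 2 ^ 2 + C (a 0 * a 6 - 2 * a 1 * a 3) * X 0 * X 1 +
        C (2 * a 0 * a 4 - a 1 * a 6) * X 0 * X 2 + C (2 * a 0 * a 5 - 2 * a 1 * a 2) * X 1 * X 2 :
        MvPolynomial (Fin 3) k) := by
  rw [pderiv_one_cubicTriangle, pderiv_two_cubicTriangle]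
  simp only [map_mul, map_sub, map_ofNat]
  ring

/-- **THE (E) INITIAL PAIR OF EVERY CUBIC CONE THROUGH THE COORDINATE TRIANGLE (OURS · W4.4 (R-QH)).** `a₀ ≠ 0`, `a₂ ≠ 0`;
`A = k[x,y,z]` with `hker` (kernel `(f_a)`), `O ∋ k` a weight valuation ring (`hx`, `hW`). With the quadrics
`Q₀ = ∂f_a/∂X₁ = a₀X₀² + 2a₂X₁X₂ + 2a₃X₀X₁ + a₅X₂² + a₆X₀X₂` and `Q₁ = a₀∂f_a/∂X₂ − a₁∂f_a/∂X₁`: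
`g₀ = Q₀(x,y,z)` and
`g₁ = Q₁(x,y,z)` lie in `ca (tower O A 0)`, `g₀ ≠ 0` has MINIMAL value on `ca`, and `g₁ g₀⁻¹` is residually transcendental over
`k` — the conclusion of `stub_initialPairOfConstantGenus` at `m' = 0`. Every field `k`. [OURS · W4.4 kill test] -/
theorem initialPair_cubicTriangle :
    MvPolynomial.aeval ![x, y, z] (C (a 0) * X 0 ^ 2 + 2 * C (a 2) * X 1 * X 2 + 2 * C (a 3) * X 0 * X 1 + C (a 5) * X 2 ^ 2 + C (a 6) * X 0 * X 2 :
        MvPolynomial (Fin 3) k) ∈ ca (tower O (MvPolynomial.aeval (R := k) (![x, y, z] : Fin 3 → K)).range 0) ∧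
    MvPolynomial.aeval ![x, y, z] (C (a 0 * a 2) * X 1 ^ 2 - C (a 1 * a 5) * X 2 ^ 2 + C (a 0 * a 6 - 2 * a 1 * a 3) * X 0 * X 1 +
        C (2 * a 0 * a 4 - a 1 * a 6) * X 0 * X 2 + C (2 * a 0 * a 5 - 2 * a 1 * a 2) * X 1 * X 2 :
        MvPolynomial (Fin 3) k) ∈ ca (tower O (MvPolynomial.aeval (R := k) (![x, y, z] : Fin 3 → K)).range 0) ∧
    MvPolynomial.aeval ![x, y, z] (C (a 0) * X 0 ^ 2 + 2 * C (a 2) * X 1 * X 2 + 2 * C (a 3) * X 0 * X 1 + C (a 5) * X 2 ^ 2 + C (a 6) * X 0 * X 2 :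
        MvPolynomial (Fin 3) k) ≠ 0 ∧
    (∀ c ∈ ca (tower O (MvPolynomial.aeval (R := k) (![x, y, z] : Fin 3 → K)).range 0),
      c * (MvPolynomial.aeval ![x, y, z]
      (C (a 0) * X 0 ^ 2 + 2 * C (a 2) * X 1 * X 2 + 2 * C (a 3) * X 0 * X 1 + C (a 5) * X 2 ^ 2 + C (a 6) * X 0 * X 2 :
        MvPolynomial (Fin 3) k))⁻¹ ∈ O) ∧
    ∀ P : Polynomial k, P ≠ 0 → ¬ O.valuation (Polynomial.aeval
      (MvPolynomial.aeval ![x, y, z] (C (a 0 * a 2) * X 1 ^ 2 - C (a 1 * a 5) * X 2 ^ 2 + C (a 0 * a 6 - 2 * a 1 * a 3) * X 0 * X 1 +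
        C (2 * a 0 * a 4 - a 1 * a 6) * X 0 * X 2 + C (2 * a 0 * a 5 - 2 * a 1 * a 2) * X 1 * X 2 :
        MvPolynomial (Fin 3) k) * (MvPolynomial.aeval ![x, y, z]
      (C (a 0) * X 0 ^ 2 + 2 * C (a 2) * X 1 * X 2 + 2 * C (a 3) * X 0 * X 1 + C (a 5) * X 2 ^ 2 + C (a 6) * X 0 * X 2 :
        MvPolynomial (Fin 3) k))⁻¹) P) < 1 := by
  set F : MvPolynomial (Fin 3) k := C (a 0) * (X 0 ^ 2 * X 1) + C (a 1) * (X 0 ^ 2 * X 2) + C (a 2) * (X 1 ^ 2 * X 2) + C (a 3) * (X 1 ^ 2 * X 0) +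
        C (a 4) * (X 2 ^ 2 * X 0) + C (a 5) * (X 2 ^ 2 * X 1) + C (a 6) * (X 0 * X 1 * X 2) with hF
  have hf0 := cubicTriangle_ne_zero a h0
  have hf3 := isHomogeneous_cubicTriangle a
  have hQ₀ := pderiv_one_cubicTriangle a
  have hQ₁ := quadric_one_cubicTriangle a
  have hfl : ∀ i : Fin 3, Ideal.Quotient.mk (Ideal.span {algebraMap (MvPolynomial (Fin 3) k) (Localization.AtPrime (originIdeal k 3)) F})
      (algebraMap (MvPolynomial (Fin 3) k) (Localization.AtPrime (originIdeal k 3)) (pderiv i F)) ∈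
      cohomologyAnnihilatorOfDegree (Localization.AtPrime (originIdeal k 3) ⧸
        Ideal.span {algebraMap (MvPolynomial (Fin 3) k) (Localization.AtPrime (originIdeal k 3)) F}) 3 :=
    fun i => mk_algebraMap_pderiv_mem_cohomologyAnnihilatorOfDegree_three' k (originIdeal k 3) rfl _ hf0 i
  have hG₀ca : Ideal.Quotient.mk
      (Ideal.span {algebraMap (MvPolynomial (Fin 3) k) (Localization.AtPrime (originIdeal k 3)) F}) (algebraMap (MvPolynomial (Fin 3) k) (Localization.AtPrime (originIdeal k 3))
      (C (a 0) * X 0 ^ 2 + 2 * C (a 2) * X 1 * X 2 + 2 * C (a 3) * X 0 * X 1 + C (a 5) * X 2 ^ 2 + C (a 6) * X 0 * X 2 :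
        MvPolynomial (Fin 3) k)) ∈ cohomologyAnnihilatorOfDegree (Localization.AtPrime (originIdeal k 3) ⧸
        Ideal.span {algebraMap (MvPolynomial (Fin 3) k) (Localization.AtPrime (originIdeal k 3)) F}) 3 := by
    rw [← hQ₀]; exact hfl 1
  have hG₁ca : Ideal.Quotient.mk
      (Ideal.span {algebraMap (MvPolynomial (Fin 3) k) (Localization.AtPrime (originIdeal k 3)) F}) (algebraMap (MvPolynomial (Fin 3) k) (Localization.AtPrime (originIdeal k 3))
      (C (a 0 * a 2) * X 1 ^ 2 - C (a 1 * a 5) * X 2 ^ 2 + C (a 0 * a 6 - 2 * a 1 * a 3) * X 0 * X 1 +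
        C (2 * a 0 * a 4 - a 1 * a 6) * X 0 * X 2 + C (2 * a 0 * a 5 - 2 * a 1 * a 2) * X 1 * X 2 :
        MvPolynomial (Fin 3) k))
      ∈ cohomologyAnnihilatorOfDegree (Localization.AtPrime (originIdeal k 3) ⧸
        Ideal.span {algebraMap (MvPolynomial (Fin 3) k) (Localization.AtPrime (originIdeal k 3)) F}) 3 := by
    rw [← hQ₁, map_sub, map_mul, map_mul, map_sub, map_mul, map_mul]
    exact Ideal.sub_mem _ (Ideal.mul_mem_left _ _ (hfl 2)) (Ideal.mul_mem_left _ _ (hfl 1))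
  have hG₀h : ((C (a 0) * X 0 ^ 2 + 2 * C (a 2) * X 1 * X 2 + 2 * C (a 3) * X 0 * X 1 + C (a 5) * X 2 ^ 2 + C (a 6) * X 0 * X 2 :
        MvPolynomial (Fin 3) k)).IsHomogeneous 2 := by rw [← hQ₀]; exact hf3.pderiv
  have hG₁h : ((C (a 0 * a 2) * X 1 ^ 2 - C (a 1 * a 5) * X 2 ^ 2 + C (a 0 * a 6 - 2 * a 1 * a 3) * X 0 * X 1 +
        C (2 * a 0 * a 4 - a 1 * a 6) * X 0 * X 2 + C (2 * a 0 * a 5 - 2 * a 1 * a 2) * X 1 * X 2 :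
        MvPolynomial (Fin 3) k)).IsHomogeneous 2 := by
    rw [← hQ₁]; exact ((hf3.pderiv (i := 2)).C_mul (a 0)).sub ((hf3.pderiv (i := 1)).C_mul (a 1))
  have hrf : MvPolynomial.aeval (R := k) (![Polynomial.X, 0, 0] : Fin 3 → Polynomial k) F = 0 := by simp [hF]
  have hr₀ : MvPolynomial.aeval (R := k) (![Polynomial.X, 0, 0] : Fin 3 → Polynomial k)
      (C (a 0) * X 0 ^ 2 + 2 * C (a 2) * X 1 * X 2 + 2 * C (a 3) * X 0 * X 1 + C (a 5) * X 2 ^ 2 + C (a 6) * X 0 * X 2 :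
        MvPolynomial (Fin 3) k) =
      Polynomial.C (a 0) * Polynomial.X ^ 2 := by simp
  have hr₁ : MvPolynomial.aeval (R := k) (![Polynomial.X, 0, 0] : Fin 3 → Polynomial k)
      (C (a 0 * a 2) * X 1 ^ 2 - C (a 1 * a 5) * X 2 ^ 2 + C (a 0 * a 6 - 2 * a 1 * a 3) * X 0 * X 1 +
        C (2 * a 0 * a 4 - a 1 * a 6) * X 0 * X 2 + C (2 * a 0 * a 5 - 2 * a 1 * a 2) * X 1 * X 2 :
        MvPolynomial (Fin 3) k) = 0 := by simp
  have hv₀ : MvPolynomial.eval (![1, 0, 0] : Fin 3 → k) F = 0 := by simp [hF]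
  have hv₀' : MvPolynomial.eval (![1, 0, 0] : Fin 3 → k)
      (C (a 0) * X 0 ^ 2 + 2 * C (a 2) * X 1 * X 2 + 2 * C (a 3) * X 0 * X 1 + C (a 5) * X 2 ^ 2 + C (a 6) * X 0 * X 2 :
        MvPolynomial (Fin 3) k) ≠ 0 := by simpa using h0
  have hv₁ : MvPolynomial.eval (![0, 1, 0] : Fin 3 → k) F = 0 := by simp [hF]
  have hv₁' : MvPolynomial.eval (![0, 1, 0] : Fin 3 → k)
      (C (a 0 * a 2) * X 1 ^ 2 - C (a 1 * a 5) * X 2 ^ 2 + C (a 0 * a 6 - 2 * a 1 * a 3) * X 0 * X 1 +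
        C (2 * a 0 * a 4 - a 1 * a 6) * X 0 * X 2 + C (2 * a 0 * a 5 - 2 * a 1 * a 2) * X 1 * X 2 :
        MvPolynomial (Fin 3) k) ≠ 0 := by simpa using mul_ne_zero h0 h2
  exact initialPair_of_data hker (eval_single_cubicTriangle a) hW hx hk
    (fun c n hc => mem_sq_of_mem_ca_cubicTriangle k (originIdeal k 3) rfl a hf0 c hc) hG₀h hG₁h hG₀ca hG₁ca h0 hrf hr₀ hr₁
    ![1, 0, 0] ![0, 1, 0] hv₀ hv₀' hv₁ hv₁'

omit h0 h2 in
/-- **EVERY CUBIC CONE THROUGH THE COORDINATE TRIANGLE EXITS (OURS · W4.4 (R-QH)).** `a₀ ≠ 0`, `a₂ ≠ 0`; in the kill test's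
binders (`p` prime, `CharP k p`, `Frac A = K`, `dim A = 2`), for `A = k[x,y,z]` the cone `f_a = 0` (`hker`) and a weight
valuation ring `O` (`hk`, `hx`, `hW`): **`∃ m, IsRegularLocalRing ↥(tower O A m)`** — `SurfaceTermination`'s conclusion for this
`(A, O)`. Over an algebraically closed field this covers every simple-elliptic `Ẽ₆` cone up to coordinates. [OURS · W4.4 kill test] -/
theorem exists_isRegularLocalRing_tower_cubicTriangle (h0 : a 0 ≠ 0) (h2 : a 2 ≠ 0) (p : ℕ) (hp : p.Prime) [CharP k p]
    (hfr : IsFractionRing ↥(MvPolynomial.aeval (R := k) (![x, y, z] : Fin 3 → K)).range K)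
    (hdim : ringKrullDim ↥(MvPolynomial.aeval (R := k) (![x, y, z] : Fin 3 → K)).range = 2) :
    ∃ m : ℕ, IsRegularLocalRing ↥(tower O (MvPolynomial.aeval (R := k) (![x, y, z] : Fin 3 → K)).range m) := by
  obtain ⟨h₀, h₁, hne, hmin, hval⟩ := initialPair_cubicTriangle hker hW hx hk h0 h2
  exact exists_isRegularLocalRing_tower_of_initialPair hker (eval_single_cubicTriangle a) hW hx hk h₀ h₁ hne hmin hval
    p hp hfr hdim

end Cone

end Summit.ResolutionOfSingularities.ResolutionOfSingularities.Theorems.SurfaceTermination.CubicTriangle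

end
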